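/- LEAD seat `ym-line-cbag-p1` (prover-ym-line-cbag-p1-g23-0; own crux stmt-QuantumFields-22254 `BoxFloorAllGroups` CLOSED proved before
this session) leading the cell's LINE 7, route `GlueballBandRecursion`, load-bearing crux `OneGlueballBandDichotomy`
(stmt-QuantumFields-27554).  RESHAPING of the registered one-stub skeleton (g22, stub `stub_bandThermalFloor`): the thermal band floor is
DISCHARGED here modulo the basis-free SPECTRAL band statement (route plan (B1), the new registered stub `stub_bandLevels`), through a
variational floor for the thermal trace that is proved in full.  Route-independent (no `Theses` import). -/
import Summits.QuantumFields.YangMills.Theorems.GlueballBandRecursionOneGlueballBandLowerDefs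
import Summits.QuantumFields.YangMills.Theorems.GlueballBandRecursionRateToolkit
import Summits.QuantumFields.YangMills.Theorems.GlueballBandRecursionRateDictionary

/-!
# Route `GlueballBandRecursion`, crux `OneGlueballBandDichotomy` (stmt-QuantumFields-27554): excited eigenfamilies sit under the
# thermal trace, and the SPECTRAL one-glueball band implies the THERMAL band floor

The crux's registered skeleton (LEAD g22, evidence `OneGlueballBandDichotomy_lead_wired.lean`) had one open stub, the thermal band floor
`stub_bandThermalFloor`: `q_N^{t}·bandSum κ N t ≤ x_t(N)` for all `2 ≤ t ≤ N`, `N ≥ L₀`, `0 ≤ β ≤ strongCouplingRadius ρ`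
(`x_t(N) = traceExcess ρ β N t = Σ_{i ≠ i₀}(λᵢ/λ₊)^t`, `q_N = ⨅ₖ x_{k+2}^{1/(k+2)} = λ₁/λ₊`, `bandSum κ N t = Σ_{p ∈ (ℤ/N)³} e^{−κ t |p̃|²/N²}`).
This file proves, for the tree's transfer matrix `𝕋 = wilsonTorusTransferMatrix ρ β N` on `L²(G^{E₃})`:

* §1 (abstract Hilbert space, [folklore]) `sum_pow_le_tsum_update_pow`: for a symmetric operator `T` diagonal in a Hilbert basis
  `(bᵢ)`, `T bᵢ = λᵢ bᵢ`, `λᵢ ≥ 0`, and ANY finite orthonormal family of eigenvectors `T e_p = μ_p e_p` with `μ_p ≠ λ_{i₀}`: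
  `Σ_p μ_p^t ≤ Σ_{i ≠ i₀} λᵢ^t` (Parseval for each `e_p` puts `μ_p^t = Σᵢ λᵢ^t ⟪bᵢ, e_p⟫²` on the indices with `λᵢ = μ_p`; Bessel
  `Σ_p ⟪bᵢ, e_p⟫² ≤ 1` for each `i`; the index `i₀` carries no weight).  "A partial trace is at most the trace."
* §2 `sum_pow_div_le_traceExcess`: hence for `β ≥ 0` and every finite orthonormal family of eigenvectors of `𝕋` with eigenvalues
  `μ_p < λ₊ = transferSpectralRadius ρ β N`, `Σ_p (μ_p/λ₊)^{m+2} ≤ traceExcess ρ β N (m+2)` — the VARIATIONAL FLOOR for the cold-torus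
  thermal multiplicity (the tree had only the one-state floor `q_N^{m+2} ≤ x_{m+2}`, `Rate.rate_pow_le_traceExcess`).
* §3 `bandThermalFloor_of_bandLevels`: the SPECTRAL BAND statement — for `N ≥ L₀` and `β` on the window, either `q_N = 0` or there are
  `N³` orthonormal excited eigenvectors `e_p`, `p ∈ (Fin N)³`, of `𝕋` with eigenvalues `λ₁·exp(−κ|p̃ − p̃₀|²/N²) ≤ μ_p < λ₊` for some
  centre `p₀` (`λ₁ = q_N λ₊`; `|·|²` the centred torus size `momSq`) — implies the thermal stub VERBATIM, for every Euclidean time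
  `t = m + 2` at once (re-centre the Gaussian sum at `p₀`, raise the level bound to the power `t`, apply §2).  This is exactly the
  finite-torus one-particle BAND statement (B1) of the route's two-layer plan, now the registered stub `stub_bandLevels` of the
  reshaped skeleton; the `q_N = 0` escape covers the trivial group / `β = 0` (rank-one transfer matrix), where the floor is `0 ≤ x_t`.

HONEST FRAMING.  Nothing here proves the spectral band statement (XL: a finite-volume, β-uniform one-particle analysis of the
strong-coupling transfer matrix — Schor 1983/84 and Faria da Veiga–O'Carroll 2026 are infinite-volume), nor the crux, nor the rung
`ColdDoublingRecursionStrongCoupling` (RECORD-type, strong coupling), and a fortiori NOT the Yang–Mills mass gap.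

References: Reed–Simon I Thm. VI.16 (Hilbert–Schmidt theorem; Parseval/Bessel); Montvay–Münster (1994) §3.2.6 (`Z = Tr Tⁿ`);
R. Schor, Nucl. Phys. B 222 (1983) 71, Commun. Math. Phys. 92 (1984) 369 (one-glueball band, infinite volume).
-/

set_option autoImplicit false

noncomputable section

open scoped InnerProductSpace BigOperators
open MeasureTheory Filter
open Literature.MathematicalPhysics.QuantumFieldTheory
open Literature.MathematicalPhysics.QuantumFieldTheory.Balaban1983to89.Missing (strongCouplingRadius
  transferSpectralRadius_pos_of_unitary)

namespace Summit.QuantumFields.YangMills.Theorems.GlueballBandRecursion.Band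

/-! ### §1 Abstract: a finite orthonormal eigenfamily sits under the eigenbasis power sum -/

section Abstract

variable {E : Type*} [NormedAddCommGroup E] [InnerProductSpace ℝ E]

/-- For a symmetric real operator, eigenvectors with different eigenvalues are orthogonal: if `T x = l x` and `T e = μ e` then
`l = μ` or `⟪x, e⟫ = 0`. [folklore] -/
theorem eq_or_inner_eq_zero_of_eigen {T : E →ₗ[ℝ] E} (hT : T.IsSymmetric) {x e : E} {l μ : ℝ}
    (hx : T x = l • x) (he : T e = μ • e) : l = μ ∨ ⟪x, e⟫_ℝ = 0 := by
  have h1 : ⟪T x, e⟫_ℝ = ⟪x, T e⟫_ℝ := hT x e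
  rw [hx, he, real_inner_smul_left, real_inner_smul_right] at h1
  by_contra h
  rw [not_or] at h
  exact h.1 (mul_right_cancel₀ h.2 h1)

variable {ι : Type*} (b : HilbertBasis ι ℝ E)

/-- **A partial trace is at most the trace** (power-sum form).  Let `T` be symmetric with `T bᵢ = λᵢ bᵢ` on a Hilbert basis
`(bᵢ)`, `λᵢ ≥ 0`, and let `(e_p)_{p ∈ P}` be a finite orthonormal family of eigenvectors, `T e_p = μ_p e_p`, whose eigenvalues avoid
`λ_{i₀}`.  Then `Σ_p μ_p^t ≤ Σ_{i ≠ i₀} λᵢ^t` (the right side as the sum of `update (λ^t) i₀ 0`, assumed summable).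
Proof: Parseval `Σᵢ ⟪bᵢ, e_p⟫² = 1` and `⟪bᵢ, e_p⟫ = 0` unless `λᵢ = μ_p` give `μ_p^t = Σᵢ λᵢ^t ⟪bᵢ, e_p⟫²` with no weight on `i₀`;
sum over `p` and use Bessel `Σ_p ⟪bᵢ, e_p⟫² ≤ ‖bᵢ‖² = 1`. [folklore] -/
theorem sum_pow_le_tsum_update_pow [DecidableEq ι] (T : E →L[ℝ] E) (hT : (T : E →ₗ[ℝ] E).IsSymmetric)
    (lam : ι → ℝ) (hb : ∀ i, T (b i) = lam i • b i) (hlam : ∀ i, 0 ≤ lam i) (i₀ : ι) (t : ℕ)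
    (hsum : Summable (Function.update (fun i => lam i ^ t) i₀ 0))
    {P : Type*} [Fintype P] (e : P → E) (he : Orthonormal ℝ e) (μ : P → ℝ)
    (hμ : ∀ p, T (e p) = μ p • e p) (hne : ∀ p, μ p ≠ lam i₀) :
    ∑ p, μ p ^ t ≤ ∑' i, Function.update (fun i => lam i ^ t) i₀ 0 i := by
  -- Parseval for each `e p` in the eigenbasis: `Σᵢ ⟪bᵢ, e_p⟫² = 1`
  have hpar : ∀ p, HasSum (fun i => ⟪b i, e p⟫_ℝ ^ 2) 1 := by
    intro p
    have h := b.hasSum_inner_mul_inner (e p) (e p)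
    have h1 : ⟪e p, e p⟫_ℝ = 1 := by
      rw [real_inner_self_eq_norm_sq, he.1 p, one_pow]
    rw [h1] at h
    refine h.congr_fun fun i => ?_
    change ⟪b i, e p⟫_ℝ ^ 2 = ⟪e p, b i⟫_ℝ * ⟪b i, e p⟫_ℝ
    rw [real_inner_comm (b i) (e p), sq]
  -- support of the coefficients: `λᵢ ≠ μ_p ⟹ ⟪bᵢ, e_p⟫ = 0`
  have hsupp : ∀ i p, lam i ^ t * ⟪b i, e p⟫_ℝ ^ 2 = μ p ^ t * ⟪b i, e p⟫_ℝ ^ 2 := by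
    intro i p
    rcases eq_or_inner_eq_zero_of_eigen hT (x := b i) (e := e p) (l := lam i) (μ := μ p)
      (by simpa using hb i) (by simpa using hμ p) with h | h
    · rw [h]
    · rw [h]
      ring
  have hc0 : ∀ p, ⟪b i₀, e p⟫_ℝ = 0 := fun p => by
    rcases eq_or_inner_eq_zero_of_eigen hT (x := b i₀) (e := e p) (l := lam i₀) (μ := μ p)
      (by simpa using hb i₀) (by simpa using hμ p) with h | h
    · exact absurd h.symm (hne p)
    · exact h
  -- `μ_p^t = Σᵢ (update λ^t i₀ 0)ᵢ ⟪bᵢ, e_p⟫²`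
  have hp : ∀ p, HasSum (fun i => Function.update (fun i => lam i ^ t) i₀ 0 i * ⟪b i, e p⟫_ℝ ^ 2) (μ p ^ t) := by
    intro p
    have h := (hpar p).mul_left (μ p ^ t)
    rw [mul_one] at h
    refine h.congr_fun fun i => ?_
    by_cases hi : i = i₀
    · subst hi
      simp [hc0 p]
    · rw [Function.update_of_ne hi, hsupp i p]
  have hP : HasSum (fun i => ∑ p, Function.update (fun i => lam i ^ t) i₀ 0 i * ⟪b i, e p⟫_ℝ ^ 2)
      (∑ p, μ p ^ t) :=
    hasSum_sum fun p _ => hp p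
  refine hasSum_le (fun i => ?_) hP hsum.hasSum
  -- termwise: Bessel `Σ_p ⟪bᵢ, e_p⟫² ≤ ‖bᵢ‖² = 1` and the weight is non-negative
  have hui : 0 ≤ Function.update (fun i => lam i ^ t) i₀ 0 i := by
    by_cases hi : i = i₀
    · subst hi
      simp
    · rw [Function.update_of_ne hi]
      exact pow_nonneg (hlam i) t
  have hB : ∑ p, ⟪b i, e p⟫_ℝ ^ 2 ≤ 1 := by
    have h := he.sum_inner_products_le (b i) (s := Finset.univ)
    rw [b.orthonormal.1 i, one_pow] at h
    refine le_trans (le_of_eq (Finset.sum_congr rfl fun p _ => ?_)) h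
    rw [real_inner_comm (b i) (e p), Real.norm_eq_abs, sq_abs]
  calc ∑ p, Function.update (fun i => lam i ^ t) i₀ 0 i * ⟪b i, e p⟫_ℝ ^ 2
      = Function.update (fun i => lam i ^ t) i₀ 0 i * ∑ p, ⟪b i, e p⟫_ℝ ^ 2 := by rw [Finset.mul_sum]
    _ ≤ Function.update (fun i => lam i ^ t) i₀ 0 i * 1 := mul_le_mul_of_nonneg_left hB hui
    _ = Function.update (fun i => lam i ^ t) i₀ 0 i := mul_one _

end Abstract

/-! ### §2 The variational floor for the cold-torus thermal multiplicity -/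

section Transfer

variable {G : Type} [Group G] [TopologicalSpace G] [IsTopologicalGroup G] [CompactSpace G]
  [MeasurableSpace G] [BorelSpace G]

/-- **Variational floor for the thermal trace.**  For `β ≥ 0`, a faithful continuous unitary `r`, and ANY finite orthonormal family
`(e_p)` of eigenvectors of the transfer matrix `𝕋 = wilsonTorusTransferMatrix r.ρ β N` with eigenvalues `μ_p < λ₊ =
transferSpectralRadius r.ρ β N`: `Σ_p (μ_p/λ₊)^{m+2} ≤ traceExcess r.ρ β N (m+2)` — every excited eigenfamily one exhibits is a floor
for the thermal multiplicity `x_{m+2}(N) = Σ_{i ≠ i₀}(λᵢ/λ₊)^{m+2}` (tree trace formula, `exists_eigenData_rate`), by §1. -/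
theorem sum_pow_div_le_traceExcess (r : LatticeRep G) {β : ℝ} (hβ : 0 ≤ β) (N : ℕ) [NeZero N]
    {P : Type*} [Fintype P]
    (e : P → Lp ℝ 2 (Measure.pi fun _ : Edge 3 N => haarProbability G)) (he : Orthonormal ℝ e)
    (μ : P → ℝ) (hμ : ∀ p, wilsonTorusTransferMatrix r.ρ β N (e p) = μ p • e p)
    (hlt : ∀ p, μ p < transferSpectralRadius r.ρ β N) (m : ℕ) :
    ∑ p, (μ p / transferSpectralRadius r.ρ β N) ^ (m + 2) ≤ traceExcess r.ρ β N (m + 2) := by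
  classical
  haveI : SecondCountableTopology G :=
    (r.continuous.isClosedEmbedding r.injective).isEmbedding.secondCountableTopology
  obtain ⟨s, _, b, lam, i₀, hb, hle, hL0, hrad, hx, -, -⟩ := exists_eigenData_rate r hβ N
  have hT := (isSelfAdjoint_wilsonTorusTransferMatrix N r.continuous r.mem_unitary β).isSymmetric
  -- the trace formula in un-normalised form: `Σ_{i ≠ i₀} λᵢ^{m+2} = x_{m+2} · λ_{i₀}^{m+2}`
  have hx' : HasSum (Function.update (fun i => lam i ^ (m + 2)) i₀ 0)
      (traceExcess r.ρ β N (m + 2) * lam i₀ ^ (m + 2)) := by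
    have h := (hx m).mul_right (lam i₀ ^ (m + 2))
    refine h.congr_fun fun i => ?_
    by_cases hi : i = i₀
    · subst hi
      simp
    · rw [Function.update_of_ne hi, Function.update_of_ne hi, div_pow,
        div_mul_cancel₀ _ (pow_ne_zero _ hL0.ne')]
  have hne : ∀ p, μ p ≠ lam i₀ := fun p => by rw [← hrad]; exact (hlt p).ne
  have h1 := sum_pow_le_tsum_update_pow b (wilsonTorusTransferMatrix r.ρ β N) hT lam hb (fun i => (hle i).1) i₀
    (m + 2) hx'.summable e he μ hμ hne
  rw [hx'.tsum_eq] at h1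
  have hΛ : 0 < transferSpectralRadius r.ρ β N := by rw [hrad]; exact hL0
  rw [hrad]
  calc ∑ p, (μ p / lam i₀) ^ (m + 2) = (∑ p, μ p ^ (m + 2)) / lam i₀ ^ (m + 2) := by
        rw [Finset.sum_div]
        exact Finset.sum_congr rfl fun p _ => div_pow _ _ _
    _ ≤ traceExcess r.ρ β N (m + 2) * lam i₀ ^ (m + 2) / lam i₀ ^ (m + 2) :=
        div_le_div_of_nonneg_right h1 (pow_nonneg hL0.le _)
    _ = traceExcess r.ρ β N (m + 2) := mul_div_cancel_right₀ _ (pow_ne_zero _ hL0.ne')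

/-! ### §3 The spectral one-glueball band implies the thermal band floor (reshaping of the crux skeleton) -/

/-- **Spectral band ⟹ thermal band floor.**  HYPOTHESIS (the reshaped skeleton's registered stub `stub_bandLevels`, route plan (B1),
the finite-torus ONE-GLUEBALL BAND in spectral form): for every compact `G` and faithful unitary `r` there are `κ > 0` and `L₀` such
that for `0 ≤ β ≤ strongCouplingRadius r.ρ` and `N ≥ L₀`, either `q_N = 0`, or there are a centre `p₀ ∈ (Fin N)³` and `N³`
orthonormal eigenvectors `e_p` of `wilsonTorusTransferMatrix r.ρ β N`, `p ∈ (Fin N)³`, with eigenvalues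
`q_N·λ₊·exp(−κ|p̃ − p̃₀|²/N²) ≤ μ_p < λ₊` (`λ₊ = transferSpectralRadius`, `q_N λ₊ = λ₁` the top excited level, `|·|² = momSq` the
centred torus size).  CONCLUSION (the former stub `stub_bandThermalFloor`, verbatim): `q_N^{m+2}·bandSum κ N (m+2) ≤
traceExcess r.ρ β N (m+2)` for all `m + 2 ≤ N`, `N ≥ L₀`, `β` on the window.  Proof: re-centre `bandSum` at `p₀`
(`p ↦ p − p₀` permutes `(Fin N)³`), bound each term `q^{t} e^{−κ t|p̃−p̃₀|²/N²} ≤ (μ_p/λ₊)^t`, and apply the variational floor §2;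
in the escape case `q_N = 0` the floor reads `0 ≤ x_t`. -/
theorem bandThermalFloor_of_bandLevels
    (hB : ∀ (G : Type) [Group G] [TopologicalSpace G] [IsTopologicalGroup G] [CompactSpace G],
      letI : MeasurableSpace G := borel G
      haveI : BorelSpace G := ⟨rfl⟩
      ∀ r : LatticeRep G, ∃ κ : ℝ, 0 < κ ∧ ∃ L₀ : ℕ, ∀ β : ℝ, 0 ≤ β → β ≤ strongCouplingRadius r.ρ →
        ∀ (N : ℕ) [NeZero N], L₀ ≤ N →
          (⨅ k : ℕ, traceExcess r.ρ β N (k + 2) ^ ((1 : ℝ) / ((k : ℝ) + 2))) = 0 ∨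
          ∃ (p₀ : Fin N × Fin N × Fin N)
            (e : Fin N × Fin N × Fin N → Lp ℝ 2 (Measure.pi fun _ : Edge 3 N => haarProbability G))
            (μ : Fin N × Fin N × Fin N → ℝ),
            Orthonormal ℝ e ∧ (∀ p, wilsonTorusTransferMatrix r.ρ β N (e p) = μ p • e p) ∧
            (∀ p, μ p < transferSpectralRadius r.ρ β N) ∧
            ∀ p, (⨅ k : ℕ, traceExcess r.ρ β N (k + 2) ^ ((1 : ℝ) / ((k : ℝ) + 2))) *
              transferSpectralRadius r.ρ β N *
                Real.exp (-(κ * (momSq N (p - p₀) : ℝ) / (N : ℝ) ^ 2)) ≤ μ p) :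
    ∀ (G : Type) [Group G] [TopologicalSpace G] [IsTopologicalGroup G] [CompactSpace G],
    letI : MeasurableSpace G := borel G
    haveI : BorelSpace G := ⟨rfl⟩
    ∀ r : LatticeRep G, ∃ κ : ℝ, 0 < κ ∧ ∃ L₀ : ℕ, ∀ β : ℝ, 0 ≤ β → β ≤ strongCouplingRadius r.ρ →
      ∀ (N : ℕ) [NeZero N] (m : ℕ), m + 2 ≤ N → L₀ ≤ N →
        (⨅ k : ℕ, traceExcess r.ρ β N (k + 2) ^ ((1 : ℝ) / ((k : ℝ) + 2))) ^ (m + 2) * bandSum κ N (m + 2) ≤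
          traceExcess r.ρ β N (m + 2) := by
  intro G _ _ _ _
  letI : MeasurableSpace G := borel G
  haveI : BorelSpace G := ⟨rfl⟩
  intro r
  obtain ⟨κ, hκ, L₀, hL₀⟩ := hB G r
  refine ⟨κ, hκ, L₀, fun β hβ0 hβ N _ m _hm hN => ?_⟩
  haveI : SecondCountableTopology G :=
    (r.continuous.isClosedEmbedding r.injective).isEmbedding.secondCountableTopology
  have hx0 : 0 ≤ traceExcess r.ρ β N (m + 2) := Rate.traceExcess_nonneg r.continuous r.mem_unitary hβ0 N m
  rcases hL₀ β hβ0 hβ N hN with hq | ⟨p₀, e, μ, he, hμ, hlt, hband⟩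
  · rw [hq, zero_pow (by omega), zero_mul]
    exact hx0
  · set q : ℝ := ⨅ k : ℕ, traceExcess r.ρ β N (k + 2) ^ ((1 : ℝ) / ((k : ℝ) + 2)) with hqdef
    set Λ : ℝ := transferSpectralRadius r.ρ β N with hΛdef
    have hΛ : 0 < Λ := transferSpectralRadius_pos_of_unitary r.ρ r.continuous r.mem_unitary hβ0 N
    have hq0 : 0 ≤ q := Rate.rate_nonneg r.continuous r.mem_unitary hβ0 N
    -- each level bound raised to the power `t = m + 2`
    have hp : ∀ p : Fin N × Fin N × Fin N,
        q ^ (m + 2) * Real.exp (-(κ * ↑(m + 2) * (momSq N (p - p₀) : ℝ) / (N : ℝ) ^ 2)) ≤ (μ p / Λ) ^ (m + 2) := by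
      intro p
      have h1 : q * Real.exp (-(κ * (momSq N (p - p₀) : ℝ) / (N : ℝ) ^ 2)) ≤ μ p / Λ := by
        rw [le_div_iff₀ hΛ]
        calc q * Real.exp (-(κ * (momSq N (p - p₀) : ℝ) / (N : ℝ) ^ 2)) * Λ
            = q * Λ * Real.exp (-(κ * (momSq N (p - p₀) : ℝ) / (N : ℝ) ^ 2)) := by ring
          _ ≤ μ p := hband p
      have h0 : 0 ≤ q * Real.exp (-(κ * (momSq N (p - p₀) : ℝ) / (N : ℝ) ^ 2)) :=
        mul_nonneg hq0 (Real.exp_nonneg _)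
      have hexp : Real.exp (-(κ * (momSq N (p - p₀) : ℝ) / (N : ℝ) ^ 2)) ^ (m + 2) =
          Real.exp (-(κ * ↑(m + 2) * (momSq N (p - p₀) : ℝ) / (N : ℝ) ^ 2)) := by
        rw [← Real.exp_nat_mul]
        congr 1
        ring
      have h2 := pow_le_pow_left₀ h0 h1 (m + 2)
      rwa [mul_pow, hexp] at h2
    calc q ^ (m + 2) * bandSum κ N (m + 2)
        = ∑ p : Fin N × Fin N × Fin N,
            q ^ (m + 2) * Real.exp (-(κ * ↑(m + 2) * (momSq N (p - p₀) : ℝ) / (N : ℝ) ^ 2)) := by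
          rw [bandSum, Finset.mul_sum]
          exact (Fintype.sum_equiv (Equiv.subRight p₀) _ _ fun p => rfl).symm
      _ ≤ ∑ p, (μ p / Λ) ^ (m + 2) := Finset.sum_le_sum fun p _ => hp p
      _ ≤ traceExcess r.ρ β N (m + 2) := sum_pow_div_le_traceExcess r hβ0 N e he μ hμ hlt m

end Transfer

end Summit.QuantumFields.YangMills.Theorems.GlueballBandRecursion.Band

end
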